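import Literature.NumberTheory.ModularForms.LevelSixSturmSetup
import HarnessLib

/-!
# The three weight-4 identities on `Γ₀(6)` behind the Chan–Zudilin parametrisation

Ninth file of the level-6 story of the four-step random walk ([BorweinEtAl2012, §4 Remark 7]:
`y₀(−t) = Z`, `Z = η(τ)⁴η(3τ)⁴/(η(2τ)²η(6τ)²)`, `t = (η(2τ)η(6τ)/(η(τ)η(3τ)))⁶`). With
`g = Dt/t = gSix`, `hSix = ϑZ/Z`, `Δ₆ = tZ²`, `W = t²Z²`, `E₄` (previous files), Sturm's bound
for weight `4` on `Γ₀(6)` (`gamma0Six_eq_zero_of_coeff`: five coefficients) proves the modular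
identities

* (R1) **`g² = Z² + 20Δ₆ + 64W`**, i.e. `(Dt/t)² = Z²(1 + 4t)(1 + 16t)` (`gSix_sq_eq`,
  `gSix_sq_eq_t`) — the ramification of the degree-2 function `t` at the singular points
  `−1/4, −1/16` of the Domb equation;
* (R2) **`ϑZ = hSix·Z = Z²/6 − Zg/3 + 8Δ₆/3`** (`hSix_mul_Z_eq`);
* (R3) **`ϑg = −(11/16)Z² + Zg/4 + g²/4 − 5Δ₆ + E₄/48`** (`serreDerivative_gSix_eq`),
* (R4) **`E₄ = 5Z² − 12Zg + 16g² + 48g·hSix + 160Δ₆ + 1280W`**, i.e.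
  `E₄ = Z(5Z − 4g + 128gt + 160tZ + 1280t²Z)` (`E4_eq_level6`, `E4_eq_level6_t`) — `E₄`
  restricted to `Γ₀(6)` in the basis `Z², Zg, gtZ, tZ², t²Z²` of `M₄(Γ₀(6))`,

each as an equality of `ModularForm (Γ₀(6)) 4` obtained from the vanishing of the coefficients
`n ≤ 4` of the difference (tables of the previous three files, `norm_num`). By the seat's algebraic
certificate these three identities (with `D E₂ = (E₂² − E₄)/12`) are exactly the modular input that
turns the Wronskian operator of `Z, τZ, τ²Z` in the variable `t` into the Domb (Picard–Fuchs)
operator `B₄`.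

## References

* [BorweinEtAl2012] J. M. Borwein, A. Straub, J. Wan, W. Zudilin, *Densities of short uniform
  random walks*, Canad. J. Math. 64 (2012), §4 Remark 7 (eq. (y0modular)).
* H. H. Chan, W. Zudilin, *New representations for Apéry-like sequences*, Mathematika 56 (2010).
* J. Sturm, *On the congruence of modular forms* (1987), Thm. 1.
-/

noncomputable section

open UpperHalfPlane hiding I
open Complex Filter Topology Finset PowerSeries Function EisensteinSeries ModularForm Derivative
open scoped Real MatrixGroups ModularForm Manifold

open Literature.NumberTheory.EllipticCurves.ModularForms

namespace Literature.NumberTheory.ModularForms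

/-! ### The differences as weight-4 forms -/

/-- The product of two weight-2 forms as a weight-4 form (Mathlib's `mul` lands in weight `2 + 2`).
[folklore] -/
def mul4 (f g : ModularForm (CongruenceSubgroup.Gamma0 6) 2) : ModularForm (CongruenceSubgroup.Gamma0 6) 4 :=
  ModularForm.mcast (by norm_num) (f.mul g)

/-- The underlying function of `mul4 f g` is `f · g`. [folklore] -/
@[simp] theorem coe_mul4 (f g : ModularForm (CongruenceSubgroup.Gamma0 6) 2) : (mul4 f g : ℍ → ℂ) = ⇑f * ⇑g := rfl

/-- The Serre derivative of a weight-2 form as a weight-4 form. [folklore] -/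
def serre4 (f : ModularForm (CongruenceSubgroup.Gamma0 6) 2) : ModularForm (CongruenceSubgroup.Gamma0 6) 4 :=
  ModularForm.mcast (by norm_num) (serreDerivativeGamma0 6 f)

/-- The underlying function of `serre4 f`. [folklore] -/
@[simp] theorem coe_serre4 (f : ModularForm (CongruenceSubgroup.Gamma0 6) 2) :
    (serre4 f : ℍ → ℂ) = serreDerivative 2 ⇑f := rfl

/-- `g² − Z² − 20Δ₆ − 64W ∈ M₄(Γ₀(6))`. [folklore] -/
def r1Form : ModularForm (CongruenceSubgroup.Gamma0 6) 4 :=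
  mul4 gSixForm gSixForm - mul4 dombModularForm dombModularForm - (20 : ℂ) • deltaSixForm - (64 : ℂ) • wSixForm

/-- `hSix·Z − Z²/6 + Zg/3 − 8Δ₆/3 ∈ M₄(Γ₀(6))`. [folklore] -/
def r2Form : ModularForm (CongruenceSubgroup.Gamma0 6) 4 :=
  mul4 hSixForm dombModularForm - (1 / 6 : ℂ) • mul4 dombModularForm dombModularForm +
    (1 / 3 : ℂ) • mul4 dombModularForm gSixForm - (8 / 3 : ℂ) • deltaSixForm

/-- `ϑg + (11/16)Z² − Zg/4 − g²/4 + 5Δ₆ − E₄/48 ∈ M₄(Γ₀(6))`. [folklore] -/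
def r3Form : ModularForm (CongruenceSubgroup.Gamma0 6) 4 :=
  serre4 gSixForm + (11 / 16 : ℂ) • mul4 dombModularForm dombModularForm -
    (1 / 4 : ℂ) • mul4 dombModularForm gSixForm - (1 / 4 : ℂ) • mul4 gSixForm gSixForm +
      (5 : ℂ) • deltaSixForm - (1 / 48 : ℂ) • E4SixForm

/-- `E₄ − 5Z² + 12Zg − 16g² − 48g·hSix − 160Δ₆ − 1280W ∈ M₄(Γ₀(6))`. [folklore] -/
def r4Form : ModularForm (CongruenceSubgroup.Gamma0 6) 4 :=
  E4SixForm - (5 : ℂ) • mul4 dombModularForm dombModularForm + (12 : ℂ) • mul4 dombModularForm gSixForm -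
    (16 : ℂ) • mul4 gSixForm gSixForm - (48 : ℂ) • mul4 gSixForm hSixForm - (160 : ℂ) • deltaSixForm -
      (1280 : ℂ) • wSixForm

/-! ### Their first five coefficients vanish -/

/-- Truncated `q`-expansion of a product of two level-6 forms. [folklore] -/
theorem trunc4_coe_mul {k₁ k₂ : ℤ} (f : ModularForm (CongruenceSubgroup.Gamma0 6) k₁)
    (g : ModularForm (CongruenceSubgroup.Gamma0 6) k₂) {a0 a1 a2 a3 a4 b0 b1 b2 b3 b4 c0 c1 c2 c3 c4 : ℂ}
    (hf : Trunc4 (qExpansion 1 ⇑f) a0 a1 a2 a3 a4) (hg : Trunc4 (qExpansion 1 ⇑g) b0 b1 b2 b3 b4)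
    (h0 : c0 = a0 * b0) (h1 : c1 = a0 * b1 + a1 * b0) (h2 : c2 = a0 * b2 + a1 * b1 + a2 * b0)
    (h3 : c3 = a0 * b3 + a1 * b2 + a2 * b1 + a3 * b0)
    (h4 : c4 = a0 * b4 + a1 * b3 + a2 * b2 + a3 * b1 + a4 * b0) :
    Trunc4 (qExpansion 1 (⇑f * ⇑g)) c0 c1 c2 c3 c4 := by
  rw [QExpansionAlgebra.qExpansion_mul_of_nice one_pos (nice_etaQuotient_of_modularForm f) (nice_etaQuotient_of_modularForm g)]
  exact hf.mul hg h0 h1 h2 h3 h4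

/-- The data: `Z², g², Zg, hSix·Z` truncated. [folklore] -/
theorem trunc4_level6_products :
    Trunc4 (qExpansion 1 (⇑dombModularForm * ⇑dombModularForm)) 1 (-8) 24 (-40) 88 ∧
      Trunc4 (qExpansion 1 (⇑gSixForm * ⇑gSixForm)) 1 12 48 156 552 ∧
        Trunc4 (qExpansion 1 (⇑dombModularForm * ⇑gSixForm)) 1 2 (-14) 38 (-142) ∧
          Trunc4 (qExpansion 1 (⇑hSixForm * ⇑dombModularForm)) (-1 / 6) (2 / 3) (10 / 3) (-82 / 3) (218 / 3) ∧
            Trunc4 (qExpansion 1 (⇑gSixForm * ⇑hSixForm)) (-1 / 6) (-1) 3 5 (-37) := by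
  have hZ := dombModularForm_coeff_le_four
  have hg := trunc4_gSix
  have hh := trunc4_hSix
  refine ⟨?_, ?_, ?_, ?_, ?_⟩
  · exact trunc4_coe_mul _ _ hZ hZ (by norm_num) (by norm_num) (by norm_num) (by norm_num) (by norm_num)
  · exact trunc4_coe_mul _ _ hg hg (by norm_num) (by norm_num) (by norm_num) (by norm_num) (by norm_num)
  · exact trunc4_coe_mul _ _ hZ hg (by norm_num) (by norm_num) (by norm_num) (by norm_num) (by norm_num)
  · exact trunc4_coe_mul _ _ hh hZ (by norm_num) (by norm_num) (by norm_num) (by norm_num) (by norm_num)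
  · exact trunc4_coe_mul _ _ hg hh (by norm_num) (by norm_num) (by norm_num) (by norm_num) (by norm_num)

/-- Linear combinations of nice functions: `q`-expansion coefficients are the same linear
combinations. [folklore] -/
theorem qExpansion_coeff_sub_of_nice {F G : ℍ → ℂ}
    (hF : Periodic (F ∘ ofComplex) 1 ∧ MDiff F ∧ IsBoundedAtImInfty F)
    (hG : Periodic (G ∘ ofComplex) 1 ∧ MDiff G ∧ IsBoundedAtImInfty G) (n : ℕ) :
    (qExpansion 1 (F - G)).coeff n = (qExpansion 1 F).coeff n - (qExpansion 1 G).coeff n := by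
  rw [QExpansionAlgebra.qExpansion_sub_of_nice one_pos hF hG, map_sub]

/-- Idem for sums. [folklore] -/
theorem qExpansion_coeff_add_of_nice {F G : ℍ → ℂ}
    (hF : Periodic (F ∘ ofComplex) 1 ∧ MDiff F ∧ IsBoundedAtImInfty F)
    (hG : Periodic (G ∘ ofComplex) 1 ∧ MDiff G ∧ IsBoundedAtImInfty G) (n : ℕ) :
    (qExpansion 1 (F + G)).coeff n = (qExpansion 1 F).coeff n + (qExpansion 1 G).coeff n := by
  rw [QExpansionAlgebra.qExpansion_add_of_nice one_pos hF hG, map_add]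

/-- Idem for scalar multiples. [folklore] -/
theorem qExpansion_coeff_smul_of_nice {F : ℍ → ℂ} (c : ℂ)
    (hF : Periodic (F ∘ ofComplex) 1 ∧ MDiff F ∧ IsBoundedAtImInfty F) (n : ℕ) :
    (qExpansion 1 (c • F)).coeff n = c * (qExpansion 1 F).coeff n := by
  rw [QExpansionAlgebra.qExpansion_smul_of_nice one_pos c hF, map_smul, smul_eq_mul]

/-- The first five coefficients of `r1Form` vanish. [folklore] -/
theorem r1Form_coeff (i : ℕ) (hi : i < 4 + 1) : (qExpansion 1 (⇑r1Form)).coeff i = 0 := by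
  obtain ⟨hZZ, hgg, -, -, -⟩ := trunc4_level6_products
  obtain ⟨z0, z1, z2, z3, z4⟩ := hZZ
  obtain ⟨g0, g1, g2, g3, g4⟩ := hgg
  obtain ⟨d0, d1, d2, d3, d4⟩ := deltaSixForm_coeff_le_four
  obtain ⟨w0, w1, w2, w3, w4⟩ := wSixForm_coeff_le_four
  have ngg := QExpansionAlgebra.nice_mul (nice_etaQuotient_of_modularForm gSixForm) (nice_etaQuotient_of_modularForm gSixForm)
  have nZZ := QExpansionAlgebra.nice_mul (nice_etaQuotient_of_modularForm dombModularForm)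
    (nice_etaQuotient_of_modularForm dombModularForm)
  have nD := nice_etaQuotient_of_modularForm deltaSixForm
  have nW := nice_etaQuotient_of_modularForm wSixForm
  have hcoe : (⇑r1Form : ℍ → ℂ) = ⇑gSixForm * ⇑gSixForm - ⇑dombModularForm * ⇑dombModularForm -
      (20 : ℂ) • ⇑deltaSixForm - (64 : ℂ) • ⇑wSixForm := by
    simp only [r1Form, ModularForm.coe_sub, ModularForm.IsGLPos.coe_smul, coe_mul4]
  rw [hcoe, qExpansion_coeff_sub_of_nice
      (QExpansionAlgebra.nice_sub (QExpansionAlgebra.nice_sub ngg nZZ) (QExpansionAlgebra.nice_smul _ nD))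
      (QExpansionAlgebra.nice_smul _ nW),
    qExpansion_coeff_sub_of_nice (QExpansionAlgebra.nice_sub ngg nZZ) (QExpansionAlgebra.nice_smul _ nD),
    qExpansion_coeff_sub_of_nice ngg nZZ, qExpansion_coeff_smul_of_nice _ nD,
    qExpansion_coeff_smul_of_nice _ nW]
  interval_cases i
  · rw [g0, z0, d0, w0]; norm_num
  · rw [g1, z1, d1, w1]; norm_num
  · rw [g2, z2, d2, w2]; norm_num
  · rw [g3, z3, d3, w3]; norm_num
  · rw [g4, z4, d4, w4]; norm_num

/-- The first five coefficients of `r2Form` vanish. [folklore] -/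
theorem r2Form_coeff (i : ℕ) (hi : i < 4 + 1) : (qExpansion 1 (⇑r2Form)).coeff i = 0 := by
  obtain ⟨hZZ, -, hZg, hhZ, -⟩ := trunc4_level6_products
  obtain ⟨z0, z1, z2, z3, z4⟩ := hZZ
  obtain ⟨m0, m1, m2, m3, m4⟩ := hZg
  obtain ⟨k0, k1, k2, k3, k4⟩ := hhZ
  obtain ⟨d0, d1, d2, d3, d4⟩ := deltaSixForm_coeff_le_four
  have nhZ := QExpansionAlgebra.nice_mul (nice_etaQuotient_of_modularForm hSixForm) (nice_etaQuotient_of_modularForm dombModularForm)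
  have nZZ := QExpansionAlgebra.nice_mul (nice_etaQuotient_of_modularForm dombModularForm)
    (nice_etaQuotient_of_modularForm dombModularForm)
  have nZg := QExpansionAlgebra.nice_mul (nice_etaQuotient_of_modularForm dombModularForm) (nice_etaQuotient_of_modularForm gSixForm)
  have nD := nice_etaQuotient_of_modularForm deltaSixForm
  have hcoe : (⇑r2Form : ℍ → ℂ) = ⇑hSixForm * ⇑dombModularForm -
      (1 / 6 : ℂ) • (⇑dombModularForm * ⇑dombModularForm) +
        (1 / 3 : ℂ) • (⇑dombModularForm * ⇑gSixForm) - (8 / 3 : ℂ) • ⇑deltaSixForm := by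
    simp only [r2Form, ModularForm.coe_sub, ModularForm.coe_add, ModularForm.IsGLPos.coe_smul, coe_mul4]
  rw [hcoe, qExpansion_coeff_sub_of_nice
      (QExpansionAlgebra.nice_add (QExpansionAlgebra.nice_sub nhZ (QExpansionAlgebra.nice_smul _ nZZ))
        (QExpansionAlgebra.nice_smul _ nZg)) (QExpansionAlgebra.nice_smul _ nD),
    qExpansion_coeff_add_of_nice (QExpansionAlgebra.nice_sub nhZ (QExpansionAlgebra.nice_smul _ nZZ))
      (QExpansionAlgebra.nice_smul _ nZg),
    qExpansion_coeff_sub_of_nice nhZ (QExpansionAlgebra.nice_smul _ nZZ),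
    qExpansion_coeff_smul_of_nice _ nZZ, qExpansion_coeff_smul_of_nice _ nZg,
    qExpansion_coeff_smul_of_nice _ nD]
  interval_cases i
  · rw [k0, z0, m0, d0]; norm_num
  · rw [k1, z1, m1, d1]; norm_num
  · rw [k2, z2, m2, d2]; norm_num
  · rw [k3, z3, m3, d3]; norm_num
  · rw [k4, z4, m4, d4]; norm_num

/-- The first five coefficients of `r3Form` vanish. [folklore] -/
theorem r3Form_coeff (i : ℕ) (hi : i < 4 + 1) : (qExpansion 1 (⇑r3Form)).coeff i = 0 := by
  obtain ⟨hZZ, hgg, hZg, -, -⟩ := trunc4_level6_products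
  obtain ⟨z0, z1, z2, z3, z4⟩ := hZZ
  obtain ⟨g0, g1, g2, g3, g4⟩ := hgg
  obtain ⟨m0, m1, m2, m3, m4⟩ := hZg
  obtain ⟨d0, d1, d2, d3, d4⟩ := deltaSixForm_coeff_le_four
  obtain ⟨e0, e1, e2, e3, e4⟩ := E4SixForm_coeff_le_four
  obtain ⟨s0, s1, s2, s3, s4⟩ :
      Trunc4 (qExpansion 1 (serreDerivative 2 ⇑gSixForm)) (-1 / 6) 9 47 231 387 :=
    serreDerivative_gSix_coeff_le_four
  have nS : Periodic ((serreDerivative 2 ⇑gSixForm) ∘ ofComplex) 1 ∧ MDiff (serreDerivative 2 ⇑gSixForm) ∧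
      IsBoundedAtImInfty (serreDerivative 2 ⇑gSixForm) := nice_etaQuotient_of_modularForm (serre4 gSixForm)
  have nZZ := QExpansionAlgebra.nice_mul (nice_etaQuotient_of_modularForm dombModularForm)
    (nice_etaQuotient_of_modularForm dombModularForm)
  have nZg := QExpansionAlgebra.nice_mul (nice_etaQuotient_of_modularForm dombModularForm) (nice_etaQuotient_of_modularForm gSixForm)
  have ngg := QExpansionAlgebra.nice_mul (nice_etaQuotient_of_modularForm gSixForm) (nice_etaQuotient_of_modularForm gSixForm)
  have nD := nice_etaQuotient_of_modularForm deltaSixForm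
  have nE := nice_etaQuotient_of_modularForm E4SixForm
  have hcoe : (⇑r3Form : ℍ → ℂ) = serreDerivative 2 ⇑gSixForm +
      (11 / 16 : ℂ) • (⇑dombModularForm * ⇑dombModularForm) - (1 / 4 : ℂ) • (⇑dombModularForm * ⇑gSixForm) -
        (1 / 4 : ℂ) • (⇑gSixForm * ⇑gSixForm) + (5 : ℂ) • ⇑deltaSixForm - (1 / 48 : ℂ) • ⇑E4SixForm := by
    simp only [r3Form, ModularForm.coe_sub, ModularForm.coe_add, ModularForm.IsGLPos.coe_smul, coe_mul4, coe_serre4]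
  have n1 := QExpansionAlgebra.nice_add nS (QExpansionAlgebra.nice_smul (11 / 16 : ℂ) nZZ)
  have n2 := QExpansionAlgebra.nice_sub n1 (QExpansionAlgebra.nice_smul (1 / 4 : ℂ) nZg)
  have n3 := QExpansionAlgebra.nice_sub n2 (QExpansionAlgebra.nice_smul (1 / 4 : ℂ) ngg)
  have n4 := QExpansionAlgebra.nice_add n3 (QExpansionAlgebra.nice_smul (5 : ℂ) nD)
  rw [hcoe, qExpansion_coeff_sub_of_nice n4 (QExpansionAlgebra.nice_smul _ nE),
    qExpansion_coeff_add_of_nice n3 (QExpansionAlgebra.nice_smul _ nD),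
    qExpansion_coeff_sub_of_nice n2 (QExpansionAlgebra.nice_smul _ ngg),
    qExpansion_coeff_sub_of_nice n1 (QExpansionAlgebra.nice_smul _ nZg),
    qExpansion_coeff_add_of_nice nS (QExpansionAlgebra.nice_smul _ nZZ),
    qExpansion_coeff_smul_of_nice _ nZZ, qExpansion_coeff_smul_of_nice _ nZg,
    qExpansion_coeff_smul_of_nice _ ngg, qExpansion_coeff_smul_of_nice _ nD,
    qExpansion_coeff_smul_of_nice _ nE]
  interval_cases i
  · rw [s0, z0, m0, g0, d0, e0]; norm_num
  · rw [s1, z1, m1, g1, d1, e1]; norm_num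
  · rw [s2, z2, m2, g2, d2, e2]; norm_num
  · rw [s3, z3, m3, g3, d3, e3]; norm_num
  · rw [s4, z4, m4, g4, d4, e4]; norm_num

/-- The first five coefficients of `r4Form` vanish. [folklore] -/
theorem r4Form_coeff (i : ℕ) (hi : i < 4 + 1) : (qExpansion 1 (⇑r4Form)).coeff i = 0 := by
  obtain ⟨hZZ, hgg, hZg, -, hgh⟩ := trunc4_level6_products
  obtain ⟨z0, z1, z2, z3, z4⟩ := hZZ
  obtain ⟨g0, g1, g2, g3, g4⟩ := hgg
  obtain ⟨m0, m1, m2, m3, m4⟩ := hZg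
  obtain ⟨k0, k1, k2, k3, k4⟩ := hgh
  obtain ⟨d0, d1, d2, d3, d4⟩ := deltaSixForm_coeff_le_four
  obtain ⟨w0, w1, w2, w3, w4⟩ := wSixForm_coeff_le_four
  obtain ⟨e0, e1, e2, e3, e4⟩ := E4SixForm_coeff_le_four
  have nE := nice_etaQuotient_of_modularForm E4SixForm
  have nZZ := QExpansionAlgebra.nice_mul (nice_etaQuotient_of_modularForm dombModularForm)
    (nice_etaQuotient_of_modularForm dombModularForm)
  have nZg := QExpansionAlgebra.nice_mul (nice_etaQuotient_of_modularForm dombModularForm) (nice_etaQuotient_of_modularForm gSixForm)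
  have ngg := QExpansionAlgebra.nice_mul (nice_etaQuotient_of_modularForm gSixForm) (nice_etaQuotient_of_modularForm gSixForm)
  have ngh := QExpansionAlgebra.nice_mul (nice_etaQuotient_of_modularForm gSixForm) (nice_etaQuotient_of_modularForm hSixForm)
  have nD := nice_etaQuotient_of_modularForm deltaSixForm
  have nW := nice_etaQuotient_of_modularForm wSixForm
  have hcoe : (⇑r4Form : ℍ → ℂ) = ⇑E4SixForm - (5 : ℂ) • (⇑dombModularForm * ⇑dombModularForm) +
      (12 : ℂ) • (⇑dombModularForm * ⇑gSixForm) - (16 : ℂ) • (⇑gSixForm * ⇑gSixForm) -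
        (48 : ℂ) • (⇑gSixForm * ⇑hSixForm) - (160 : ℂ) • ⇑deltaSixForm - (1280 : ℂ) • ⇑wSixForm := by
    simp only [r4Form, ModularForm.coe_sub, ModularForm.coe_add, ModularForm.IsGLPos.coe_smul, coe_mul4]
  have n1 := QExpansionAlgebra.nice_sub nE (QExpansionAlgebra.nice_smul (5 : ℂ) nZZ)
  have n2 := QExpansionAlgebra.nice_add n1 (QExpansionAlgebra.nice_smul (12 : ℂ) nZg)
  have n3 := QExpansionAlgebra.nice_sub n2 (QExpansionAlgebra.nice_smul (16 : ℂ) ngg)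
  have n4 := QExpansionAlgebra.nice_sub n3 (QExpansionAlgebra.nice_smul (48 : ℂ) ngh)
  have n5 := QExpansionAlgebra.nice_sub n4 (QExpansionAlgebra.nice_smul (160 : ℂ) nD)
  rw [hcoe, qExpansion_coeff_sub_of_nice n5 (QExpansionAlgebra.nice_smul _ nW),
    qExpansion_coeff_sub_of_nice n4 (QExpansionAlgebra.nice_smul _ nD),
    qExpansion_coeff_sub_of_nice n3 (QExpansionAlgebra.nice_smul _ ngh),
    qExpansion_coeff_sub_of_nice n2 (QExpansionAlgebra.nice_smul _ ngg),
    qExpansion_coeff_add_of_nice n1 (QExpansionAlgebra.nice_smul _ nZg),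
    qExpansion_coeff_sub_of_nice nE (QExpansionAlgebra.nice_smul _ nZZ),
    qExpansion_coeff_smul_of_nice _ nZZ, qExpansion_coeff_smul_of_nice _ nZg,
    qExpansion_coeff_smul_of_nice _ ngg, qExpansion_coeff_smul_of_nice _ ngh,
    qExpansion_coeff_smul_of_nice _ nD, qExpansion_coeff_smul_of_nice _ nW]
  interval_cases i
  · rw [e0, z0, m0, g0, k0, d0, w0]; norm_num
  · rw [e1, z1, m1, g1, k1, d1, w1]; norm_num
  · rw [e2, z2, m2, g2, k2, d2, w2]; norm_num
  · rw [e3, z3, m3, g3, k3, d3, w3]; norm_num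
  · rw [e4, z4, m4, g4, k4, d4, w4]; norm_num

/-! ### The identities -/

/-- `r1Form = 0`, `r2Form = 0`, `r3Form = 0` (Sturm). [folklore] -/
theorem rForms_eq_zero : r1Form = 0 ∧ r2Form = 0 ∧ r3Form = 0 ∧ r4Form = 0 :=
  ⟨gamma0Six_eq_zero_of_coeff (k := 4) r1Form r1Form_coeff,
    gamma0Six_eq_zero_of_coeff (k := 4) r2Form r2Form_coeff,
    gamma0Six_eq_zero_of_coeff (k := 4) r3Form r3Form_coeff,
    gamma0Six_eq_zero_of_coeff (k := 4) r4Form r4Form_coeff⟩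

/-- **(R1) `g² = Z² + 20Δ₆ + 64W`** pointwise on `ℍ` (`g = Dt/t`, `Δ₆ = tZ²`, `W = t²Z²`).
[cite: BorweinEtAl2012, §4 Remark 7] -/
theorem gSix_sq_eq (τ : ℍ) :
    gSixForm τ ^ 2 = etaQuotient 6 dombExponents τ ^ 2 + 20 * etaQuotient 6 deltaSixExponents τ +
      64 * etaQuotient 6 wSixExponents τ := by
  have h := congrArg (fun F : ModularForm (CongruenceSubgroup.Gamma0 6) 4 => (F : ℍ → ℂ) τ) rForms_eq_zero.1
  simp only [r1Form, ModularForm.coe_sub, ModularForm.IsGLPos.coe_smul, coe_mul4, ModularForm.coe_zero,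
    Pi.sub_apply, Pi.smul_apply, Pi.mul_apply, Pi.zero_apply, smul_eq_mul, coe_dombModularForm,
    coe_deltaSixForm, coe_wSixForm] at h
  linear_combination h

/-- **(R1) in the `t`-variable: `(Dt/t)² = Z²(1 + 4t)(1 + 16t)`.** [cite: BorweinEtAl2012, §4 Remark 7] -/
theorem gSix_sq_eq_t (τ : ℍ) :
    gSixForm τ ^ 2 = etaQuotient 6 dombExponents τ ^ 2 *
      ((1 + 4 * etaQuotient 6 dombHauptmodulExponents τ) * (1 + 16 * etaQuotient 6 dombHauptmodulExponents τ)) := by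
  rw [gSix_sq_eq, deltaSix_eq, wSix_eq]
  ring

/-- **(R2) `ϑZ = hSix·Z = Z²/6 − Zg/3 + 8Δ₆/3`** pointwise. [cite: BorweinEtAl2012, §4 Remark 7] -/
theorem hSix_mul_Z_eq (τ : ℍ) :
    hSixForm τ * etaQuotient 6 dombExponents τ =
      etaQuotient 6 dombExponents τ ^ 2 / 6 - etaQuotient 6 dombExponents τ * gSixForm τ / 3 +
        8 * etaQuotient 6 deltaSixExponents τ / 3 := by
  have h := congrArg (fun F : ModularForm (CongruenceSubgroup.Gamma0 6) 4 => (F : ℍ → ℂ) τ) rForms_eq_zero.2.1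
  simp only [r2Form, ModularForm.coe_sub, ModularForm.coe_add, ModularForm.IsGLPos.coe_smul, coe_mul4,
    ModularForm.coe_zero, Pi.sub_apply, Pi.add_apply, Pi.smul_apply, Pi.mul_apply, Pi.zero_apply,
    smul_eq_mul, coe_dombModularForm, coe_deltaSixForm] at h
  linear_combination h

/-- **(R2) divided by `Z`: `hSix = Z/6 − g/3 + 8tZ/3`.** [cite: BorweinEtAl2012, §4 Remark 7] -/
theorem hSix_eq (τ : ℍ) :
    hSixForm τ = etaQuotient 6 dombExponents τ / 6 - gSixForm τ / 3 +
      8 * etaQuotient 6 dombHauptmodulExponents τ * etaQuotient 6 dombExponents τ / 3 := by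
  have h := hSix_mul_Z_eq τ
  rw [deltaSix_eq] at h
  have hZ : etaQuotient 6 dombExponents τ ≠ 0 := etaQuotient_ne_zero 6 _ τ
  have h' : (hSixForm τ - (etaQuotient 6 dombExponents τ / 6 - gSixForm τ / 3 +
      8 * etaQuotient 6 dombHauptmodulExponents τ * etaQuotient 6 dombExponents τ / 3)) *
        etaQuotient 6 dombExponents τ = 0 := by
    linear_combination h
  have := (mul_eq_zero.mp h').resolve_right hZ
  linear_combination this

/-- **(R3) `ϑg = −(11/16)Z² + Zg/4 + g²/4 − 5Δ₆ + E₄/48`** pointwise (`ϑg = Dg − E₂g/6`).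
[cite: BorweinEtAl2012, §4 Remark 7] -/
theorem serreDerivative_gSix_eq (τ : ℍ) :
    serreDerivative 2 ⇑gSixForm τ =
      -(11 / 16) * etaQuotient 6 dombExponents τ ^ 2 + etaQuotient 6 dombExponents τ * gSixForm τ / 4 +
        gSixForm τ ^ 2 / 4 - 5 * etaQuotient 6 deltaSixExponents τ + ModularForm.E₄ τ / 48 := by
  have h := congrArg (fun F : ModularForm (CongruenceSubgroup.Gamma0 6) 4 => (F : ℍ → ℂ) τ) rForms_eq_zero.2.2.1
  simp only [r3Form, ModularForm.coe_sub, ModularForm.coe_add, ModularForm.IsGLPos.coe_smul, coe_mul4, coe_serre4,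
    ModularForm.coe_zero, Pi.sub_apply, Pi.add_apply, Pi.smul_apply, Pi.mul_apply, Pi.zero_apply,
    smul_eq_mul, coe_dombModularForm, coe_deltaSixForm] at h
  have hE : (E4SixForm : ℍ → ℂ) τ = ModularForm.E₄ τ := rfl
  rw [hE] at h
  linear_combination h

/-- **(R4) `E₄ = 5Z² − 12Zg + 16g² + 48g·hSix + 160Δ₆ + 1280W`** pointwise: Mathlib's level-one
`E₄` in terms of the level-6 forms. [folklore] -/
theorem E4_eq_level6 (τ : ℍ) :
    ModularForm.E₄ τ = 5 * etaQuotient 6 dombExponents τ ^ 2 - 12 * etaQuotient 6 dombExponents τ * gSixForm τ +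
      16 * gSixForm τ ^ 2 + 48 * gSixForm τ * hSixForm τ + 160 * etaQuotient 6 deltaSixExponents τ +
        1280 * etaQuotient 6 wSixExponents τ := by
  have h := congrArg (fun F : ModularForm (CongruenceSubgroup.Gamma0 6) 4 => (F : ℍ → ℂ) τ) rForms_eq_zero.2.2.2
  simp only [r4Form, ModularForm.coe_sub, ModularForm.coe_add, ModularForm.IsGLPos.coe_smul, coe_mul4,
    ModularForm.coe_zero, Pi.sub_apply, Pi.add_apply, Pi.smul_apply, Pi.mul_apply, Pi.zero_apply,
    smul_eq_mul, coe_dombModularForm, coe_deltaSixForm, coe_wSixForm] at h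
  have hE : (E4SixForm : ℍ → ℂ) τ = ModularForm.E₄ τ := rfl
  rw [hE] at h
  linear_combination h

/-- **(R4) in the `t`-variable: `E₄ = Z·(5Z − 4g + 128gt + 160tZ + 1280t²Z)`.** [folklore] -/
theorem E4_eq_level6_t (τ : ℍ) :
    ModularForm.E₄ τ = etaQuotient 6 dombExponents τ *
      (5 * etaQuotient 6 dombExponents τ - 4 * gSixForm τ +
        128 * gSixForm τ * etaQuotient 6 dombHauptmodulExponents τ +
          160 * etaQuotient 6 dombHauptmodulExponents τ * etaQuotient 6 dombExponents τ +
            1280 * etaQuotient 6 dombHauptmodulExponents τ ^ 2 * etaQuotient 6 dombExponents τ) := by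
  rw [E4_eq_level6, hSix_eq, deltaSix_eq, wSix_eq]
  ring

end Literature.NumberTheory.ModularForms

end
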